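import Summits.Ventures.HSemireg.WedgeKunneth
import Summits.Ventures.HSemireg.WedgePairRank
import Summits.Ventures.HSemireg.FormulaNUniform

/-!
# Venture HSemireg — STRUCTURE C10 (family A PLAIN MEMBER) uniformly in `n`: the rank polynomial of the `n`-fold surface box
# `f₁ ∧ ⋯ ∧ f_n` is `(1 + 4t + t²)ⁿ`; in degree 2 the rank is `8n² − 7n` and the kernel `5n` — th-7's Künneth law ITERATED in the kernel

HONEST FRAMING. Part of the Lean index of the computation cell `pub-hsemireg` (seat p10 gen 2, Sunday typer «UNIFORM-IN-n»).
Finite-dimensional EXTERIOR ALGEBRA over a field ONLY: no variety, no cohomology theory, no sheaf, no semiregularity map is constructed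
here; nothing here says that HC / HC_CM / HC_AV holds; no Literature fact is declared or used.

STRUCTURE.md v1.0-SIGNED §1.1 C10 «FAMILY A PLAIN MEMBER (n surface factors): `F_n = I_{p₁} ⊠ … ⊠ I_{pₙ}` on `(E_K²)ⁿ` … HT²-rank /
kernel and dim Ext² — rank = dim Ext² = 8n² − 7n = n + 16·C(n,2) (Künneth over e = (1,4,1) per surface factor: one factor in Ext² (n ways)
or two factors in Ext¹ ⊗ Ext¹ (16·C(n,2))); ker = 5n» (th-7 PART B §E «A-plain: (1+4t+t²)ⁿ, 8n²−7n, ker 5n … PROVED ∀n» on paper;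
measured ×3–×5 for `n ≤ 5`, bench `n ≤ 8`; `FormulaNUniform.lean` typed the NUMBERS `plainFamilyARank n = n + 16·C(n,2)`,
`plainFamilyAKer n = 5n`).  Here the CLASS SIDE becomes a kernel theorem for EVERY `n ≥ 1`, by ITERATING th-7's Künneth law
(`Wedge.Kunneth.rankPoly_mul`, `finrank_V_emb`, tree) over `n` surface blocks:
* the model: `4n` generators `Fin (4n)` in `n` blocks `D i = {4i, …, 4i+3}`; on block `i` the SURFACE point pair
  `f_i = a·E_{X_i} + c·E_{Y_i}` (`X_i = {4i, 4i+1}`, `Y_i = {4i+2, 4i+3}`; th-7's `WedgePair.pointPair` at `n = 2`, embedded along the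
  order embedding `Fin 4 ↪o Fin (4n)`), whose intrinsic rank polynomial is `1 + 4t + t²` (`rankPoly_fac`: THEOREM T at `n = 2`,
  `WedgePair.finrank_range_wedgeMap_pointPair`, plus vanishing in degrees `≥ 3`);
* **`rankPoly_surfaceBox`**: the rank polynomial of `F_n := f₀ ∧ ⋯ ∧ f_{n−1}` on all of `⋀ K^{4n}` is `(1 + 4t + t²)ⁿ`;
* **`finrank_range_surfaceBox`**: `rank(θ ↦ θ ∧ F_n ∣ ⋀^k K^{4n}) = [t^k](1 + 4t + t²)ⁿ` for every `k`; **degree 2**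
  (`finrank_range_surfaceBox_two`, `…_ker_…`): rank `= plainFamilyARank n = n + 16·C(n,2) = 8n² − 7n` and `dim ker = 5n` — C10's
  class-side integers for ALL `n ≥ 1` (`66/51/15`, `120/100/20`, `190/165/25` at `n = 3, 4, 5` as instances).
DICTIONARY (quoted, NOT asserted; th-7 PART B §A.3 / §E): block `i` ↔ the surface factor `E_K²`, `X_i ↔ H⁰(T)`-, `Y_i ↔ H¹(𝒪)`-directions,
`f_i ↔ ch(I_{p_i})` (sign-blind), `θ ↦ θ ∧ F_n ↔ ⌟ch(F_n)` on `HT^k((E²)ⁿ)`; the Ext side (`dim Ext² = 8n² − 7n`, so `ev` onto and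
`σ` injective: «SEMIREG·CLASS-DEAD») stays on paper / by value.
-/

open Module Set Set.powersetCard Polynomial

namespace Summit.Ventures.HSemireg.Wedge.SurfacePowers

open Summit.Ventures.HSemireg.Wedge Summit.Ventures.HSemireg.Wedge.Kunneth

variable (K : Type*) [Field K]

/-! ## §1. The surface factor on four generators: rank polynomial `1 + 4t + t²` -/

/-- th-7's point pair `a·E_X + c·E_Y` at `n = 2` (blocks `X = {0,1}`, `Y = {2,3}` of `Fin 4`), in the generic wedge model on
`Fin (2+2)` (the same exterior algebra `⋀ K⁴`). -/
noncomputable def surf (a c : K) : HT K (Fin (2 + 2)) := WedgePair.pointPair K 2 a c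

/-- th-7's two monomial bases on four generators agree (both are `Basis.ExteriorAlgebra` of the standard basis). -/
lemma B_pair_eq (s : Finset (Fin (2 + 2))) : WedgePair.B K 2 s = B K (Fin (2 + 2)) s := rfl

/-- the surface factor is homogeneous of degree `2`. -/
lemma surf_mem_Hom (a c : K) : surf K a c ∈ Hom K (Fin (2 + 2)) Finset.univ 2 := by
  unfold surf WedgePair.pointPair
  refine Submodule.add_mem _ (Submodule.smul_mem _ _ ?_) (Submodule.smul_mem _ _ ?_)
  · rw [WedgePair.coe_Xpc, B_pair_eq]
    exact B_mem_Hom K (Finset.subset_univ _) (WedgePair.card_Xset 2)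
  · rw [WedgePair.coe_Ypc, B_pair_eq]
    exact B_mem_Hom K (Finset.subset_univ _) (WedgePair.card_Yset 2)

/-- intrinsic ranks of the surface factor in degrees `0, 1, 2`: `1, 4, 1` (THEOREM T at `n = 2`). -/
lemma finrank_range_wedge_surf_le {k : ℕ} (hk : k ≤ 2) {a c : K} (ha : a ≠ 0) (hc : c ≠ 0) :
    finrank K (LinearMap.range (wedge K (Fin (2 + 2)) k (surf K a c))) = WedgePair.pointPairRank 2 k :=
  WedgePair.finrank_range_wedgeMap_pointPair K (by omega) hk ha hc

/-- in degrees `≥ 3` the surface factor kills everything (a `3`-subset of `Fin 4` meets both blocks). -/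
lemma range_wedge_surf_eq_bot {k : ℕ} (hk : 2 < k) (a c : K) :
    LinearMap.range (wedge K (Fin (2 + 2)) k (surf K a c)) = ⊥ := by
  rw [show wedge K (Fin (2 + 2)) k (surf K a c) = WedgePair.wedgeMap K 2 k (WedgePair.pointPair K 2 a c) from rfl,
    WedgePair.range_wedgeMap, Submodule.span_eq_bot]
  rintro _ ⟨s, rfl⟩
  have hX : ¬ Disjoint s.val (WedgePair.Xpc 2).val := fun h => by
    have h1 := Finset.card_le_card (WedgePair.disjoint_X_iff_subset_Y.mp h)
    rw [card_eq s, WedgePair.card_Yset] at h1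
    omega
  have hY : ¬ Disjoint s.val (WedgePair.Ypc 2).val := fun h => by
    have h1 := Finset.card_le_card (WedgePair.disjoint_Y_iff_subset_X.mp h)
    rw [card_eq s, WedgePair.card_Xset] at h1
    omega
  show WedgePair.B K 2 s * WedgePair.pointPair K 2 a c = 0
  rw [WedgePair.B_mul_pointPair, WedgePair.B_mul_of_not_disjoint K s _ hX, WedgePair.B_mul_of_not_disjoint K s _ hY,
    smul_zero, smul_zero, add_zero]

/-- `1 + 4t + t²` (`= P_2(t)`, the surface point pair's rank polynomial), over `ℕ`. -/
noncomputable def surfPoly : Polynomial ℕ := monomial 0 1 + monomial 1 4 + monomial 2 1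

/-- coefficients of `1 + 4t + t²`. -/
lemma coeff_surfPoly (k : ℕ) :
    surfPoly.coeff k = if k = 0 then 1 else if k = 1 then 4 else if k = 2 then 1 else 0 := by
  simp only [surfPoly, coeff_add, coeff_monomial]
  split_ifs <;> omega

/-- `1 + 4t + t²` has the point-pair ranks `(1, 4, 1)` as its first coefficients. -/
lemma coeff_surfPoly_eq_pointPairRank {k : ℕ} (hk : k ≤ 2) : surfPoly.coeff k = WedgePair.pointPairRank 2 k := by
  rw [coeff_surfPoly, WedgePair.pointPairRank]
  interval_cases k <;> decide

/-! ## §2. `n` surface blocks inside `Fin (4n)` -/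

variable (n : ℕ)

/-- the order embedding of block `i`: `j ↦ 4i + j`. -/
def blockEmb (i : Fin n) : Fin (2 + 2) ↪o Fin (4 * n) :=
  OrderEmbedding.ofStrictMono (fun j => ⟨4 * i + j, by have := i.2; have := j.2; omega⟩)
    (fun j j' h => by rw [Fin.lt_def] at h ⊢; simp only; omega)

/-- the value of the block embedding. -/
@[simp] lemma blockEmb_val (i : Fin n) (j : Fin (2 + 2)) : ((blockEmb n i j : Fin (4 * n)) : ℕ) = 4 * i + j := rfl

/-- block `i`: the generators `4i, …, 4i+3`. -/
def D (i : Fin n) : Finset (Fin (4 * n)) := Finset.univ.map (blockEmb n i).toEmbedding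

/-- membership in block `i` by value. -/
lemma mem_D {i : Fin n} {x : Fin (4 * n)} : x ∈ D n i ↔ 4 * (i : ℕ) ≤ x ∧ (x : ℕ) < 4 * i + 4 := by
  rw [D, Finset.mem_map]
  constructor
  · rintro ⟨j, -, rfl⟩
    have := j.2
    simp only [RelEmbedding.coe_toEmbedding, blockEmb_val]
    omega
  · rintro ⟨h1, h2⟩
    refine ⟨⟨x - 4 * i, by omega⟩, Finset.mem_univ _, Fin.ext ?_⟩
    simp only [RelEmbedding.coe_toEmbedding, blockEmb_val]
    omega

/-- the first `j` blocks: generators `< 4j`. -/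
def U (j : ℕ) : Finset (Fin (4 * n)) := Finset.univ.filter fun x => (x : ℕ) < 4 * j

/-- membership in `U j`. -/
lemma mem_U {j : ℕ} {x : Fin (4 * n)} : x ∈ U n j ↔ (x : ℕ) < 4 * j := by simp [U]

/-- `U (j+1) = U j ⊔ D j`. -/
lemma U_succ {j : ℕ} (hj : j < n) : U n (j + 1) = U n j ∪ D n ⟨j, hj⟩ := by
  ext x
  rw [Finset.mem_union, mem_U, mem_U, mem_D]
  simp only
  omega

/-- `U j` and block `j` are disjoint. -/
lemma disjoint_U_D {j : ℕ} (hj : j < n) : Disjoint (U n j) (D n ⟨j, hj⟩) := by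
  rw [Finset.disjoint_left]
  intro x h1 h2
  rw [mem_U] at h1
  rw [mem_D] at h2
  simp only at h2
  omega

/-- `U 1 = D 0`. -/
lemma U_one (hn : 0 < n) : U n 1 = D n ⟨0, hn⟩ := by
  ext x
  rw [mem_U, mem_D]
  simp only
  omega

/-- all `n` blocks cover the generators. -/
lemma U_self : U n n = Finset.univ := by
  ext x
  simp only [mem_U, Finset.mem_univ, iff_true]
  have := x.2
  omega

/-! ## §3. The surface factors and their product -/

variable {n}

/-- the `i`-th surface factor `f_i = a·E_{X_i} + c·E_{Y_i}` inside `⋀ K^{4n}`. -/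
noncomputable def fac (a c : K) (i : Fin n) : HT K (Fin (4 * n)) := emb K (blockEmb n i) (surf K a c)

/-- `f_i` is homogeneous of degree `2`, supported on block `i`. -/
lemma fac_mem_Hom (a c : K) (i : Fin n) : fac K a c i ∈ Hom K (Fin (4 * n)) (D n i) 2 :=
  emb_mem_Hom K (blockEmb n i) (surf_mem_Hom K a c)

/-- **the rank polynomial of a surface factor is `1 + 4t + t²`** (intrinsic THEOREM T at `n = 2`, transported by `finrank_V_emb`). -/
theorem rankPoly_fac {a c : K} (ha : a ≠ 0) (hc : c ≠ 0) (i : Fin n) :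
    rankPoly K (Fin (4 * n)) (D n i) (fac K a c i) = surfPoly := by
  ext k
  rw [coeff_rankPoly, D, fac, finrank_V_emb]
  rcases Nat.lt_or_ge 2 k with hk | hk
  · rw [range_wedge_surf_eq_bot K hk, finrank_bot, coeff_surfPoly]
    have h0 : k ≠ 0 := by omega
    have h1 : k ≠ 1 := by omega
    have h2 : k ≠ 2 := by omega
    simp [h0, h1, h2]
  · rw [finrank_range_wedge_surf_le K hk ha hc, coeff_surfPoly_eq_pointPairRank hk]

/-- the product of the first `j` surface factors, `F_j = f₀ ∧ ⋯ ∧ f_{j−1}` (`F_0 = 1`). -/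
noncomputable def prodFac (a c : K) : ℕ → HT K (Fin (4 * n))
  | 0 => 1
  | j + 1 => prodFac a c j * (if h : j < n then fac K a c ⟨j, h⟩ else 1)

/-- the `n`-fold SURFACE BOX `F_n = f₀ ∧ ⋯ ∧ f_{n−1}` on `⋀ K^{4n}` (model of `ch(I_{p₁} ⊠ ⋯ ⊠ I_{pₙ})` on `(E²)ⁿ`, sign-blind). -/
noncomputable def surfaceBox (a c : K) : HT K (Fin (4 * n)) := prodFac K (n := n) a c n

/-- the product of the first `j ≥ 1` factors is homogeneous of degree `2j` on `U j`, with rank polynomial `(1 + 4t + t²)^j`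
(th-7's `rankPoly_mul` / `mul_mem_Hom`, iterated). -/
theorem prodFac_spec {a c : K} (ha : a ≠ 0) (hc : c ≠ 0) :
    ∀ j, 1 ≤ j → j ≤ n →
      prodFac K (n := n) a c j ∈ Hom K (Fin (4 * n)) (U n j) (2 * j) ∧
        rankPoly K (Fin (4 * n)) (U n j) (prodFac K (n := n) a c j) = surfPoly ^ j := by
  intro j hj1 hjn
  induction j with
  | zero => omega
  | succ j ih =>
    have hj : j < n := by omega
    rcases Nat.eq_zero_or_pos j with rfl | hjpos
    · -- one factor
      have e : prodFac K (n := n) a c 1 = fac K a c ⟨0, hj⟩ := by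
        show 1 * _ = _
        rw [one_mul, dif_pos hj]
      rw [e, U_one n hj, pow_one]
      exact ⟨fac_mem_Hom K a c _, rankPoly_fac K ha hc _⟩
    · obtain ⟨hHom, hPoly⟩ := ih hjpos (by omega)
      have e : prodFac K (n := n) a c (j + 1) = prodFac K (n := n) a c j * fac K a c ⟨j, hj⟩ := by
        show _ * _ = _
        rw [dif_pos hj]
      rw [e, U_succ n hj]
      refine ⟨?_, ?_⟩
      · have := mul_mem_Hom K (disjoint_U_D n hj) hHom (fac_mem_Hom K a c ⟨j, hj⟩)
        rwa [show 2 * j + 2 = 2 * (j + 1) by ring] at this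
      · rw [rankPoly_mul K (disjoint_U_D n hj) hHom (fac_mem_Hom K a c ⟨j, hj⟩), hPoly, rankPoly_fac K ha hc, pow_succ]

/-- **THE RANK POLYNOMIAL OF THE `n`-FOLD SURFACE BOX IS `(1 + 4t + t²)ⁿ`** (`n ≥ 1`; th-7 PART B §E / §N.7 (a) «surface powers
`(1+4t+t²)ⁿ` by iteration», FORMULA-N Σ2 «rank polynomials multiply»). -/
theorem rankPoly_surfaceBox (hn : 1 ≤ n) {a c : K} (ha : a ≠ 0) (hc : c ≠ 0) :
    rankPoly K (Fin (4 * n)) Finset.univ (surfaceBox K (n := n) a c) = surfPoly ^ n := by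
  rw [← U_self n]
  exact ((prodFac_spec K ha hc) n hn le_rfl).2

/-- **`rank(θ ↦ θ ∧ F_n ∣ ⋀^k K^{4n}) = [t^k] (1 + 4t + t²)ⁿ`** for every `k` (`n ≥ 1`). -/
theorem finrank_range_surfaceBox (hn : 1 ≤ n) {a c : K} (ha : a ≠ 0) (hc : c ≠ 0) (k : ℕ) :
    finrank K (LinearMap.range (wedge K (Fin (4 * n)) k (surfaceBox K (n := n) a c))) = (surfPoly ^ n).coeff k := by
  rw [← V_univ, ← coeff_rankPoly, rankPoly_surfaceBox K hn ha hc]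

/-! ## §4. Degree 2: `8n² − 7n` and kernel `5n` (STRUCTURE C10), all `n ≥ 1` -/

/-- `[t²] (1 + 4t + t²)ⁿ = n + 16·C(n,2)` (one factor in degree 2, or two factors in degree 1: C10's «Künneth over e = (1,4,1)»),
together with `[t⁰] = 1`, `[t¹] = 4n` and `[t³] = 64·C(n,3) + 8·C(n,2)` (three factors in degree 1, or one in degree 2 and one in
degree 1). -/
theorem coeff_surfPoly_pow (n : ℕ) :
    (surfPoly ^ n).coeff 0 = 1 ∧ (surfPoly ^ n).coeff 1 = 4 * n ∧ (surfPoly ^ n).coeff 2 = n + 16 * n.choose 2 ∧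
      (surfPoly ^ n).coeff 3 = 64 * n.choose 3 + 8 * n.choose 2 := by
  induction n with
  | zero => simp [coeff_one]
  | succ m ih =>
    obtain ⟨h0, h1, h2, h3⟩ := ih
    rw [pow_succ]
    refine ⟨?_, ?_, ?_, ?_⟩
    · rw [coeff_mul, Finset.Nat.antidiagonal_zero, Finset.sum_singleton, h0, coeff_surfPoly]
      simp
    · rw [coeff_mul, Finset.Nat.sum_antidiagonal_succ, Finset.Nat.antidiagonal_zero, Finset.sum_singleton]
      simp only [h0, h1, coeff_surfPoly]
      simp
      ring
    · rw [coeff_mul, Finset.Nat.sum_antidiagonal_succ, Finset.Nat.sum_antidiagonal_succ, Finset.Nat.antidiagonal_zero,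
        Finset.sum_singleton]
      simp only [h0, h1, h2, coeff_surfPoly]
      simp [Nat.choose_succ_succ', Nat.choose_one_right]
      ring
    · rw [coeff_mul, Finset.Nat.sum_antidiagonal_succ, Finset.Nat.sum_antidiagonal_succ, Finset.Nat.sum_antidiagonal_succ,
        Finset.Nat.antidiagonal_zero, Finset.sum_singleton]
      simp only [h0, h1, h2, h3, coeff_surfPoly]
      simp [Nat.choose_succ_succ', Nat.choose_one_right]
      ring

/-- degree 1, uniformly in `n ≥ 1`: `rank(θ ↦ θ ∧ F_n ∣ ⋀¹ K^{4n}) = 4n` (th-7 §K / C10′: «σ¹ = 4n»; one factor in degree 1). -/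
theorem finrank_range_surfaceBox_one (hn : 1 ≤ n) {a c : K} (ha : a ≠ 0) (hc : c ≠ 0) :
    finrank K (LinearMap.range (wedge K (Fin (4 * n)) 1 (surfaceBox K (n := n) a c))) = 4 * n := by
  rw [finrank_range_surfaceBox K hn ha hc, (coeff_surfPoly_pow n).2.1]

/-- **C10, uniformly in `n ≥ 1`: `rank(θ ↦ θ ∧ F_n ∣ ⋀² K^{4n}) = plainFamilyARank n = n + 16·C(n,2)` (`= 8n² − 7n`).** -/
theorem finrank_range_surfaceBox_two (hn : 1 ≤ n) {a c : K} (ha : a ≠ 0) (hc : c ≠ 0) :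
    finrank K (LinearMap.range (wedge K (Fin (4 * n)) 2 (surfaceBox K (n := n) a c))) =
      FormulaN.Uniform.plainFamilyARank n := by
  rw [finrank_range_surfaceBox K hn ha hc, (coeff_surfPoly_pow n).2.2.1]
  rfl

/-- `… + 7n = 8n²`. -/
theorem finrank_range_surfaceBox_two_closed (hn : 1 ≤ n) {a c : K} (ha : a ≠ 0) (hc : c ≠ 0) :
    finrank K (LinearMap.range (wedge K (Fin (4 * n)) 2 (surfaceBox K (n := n) a c))) + 7 * n = 8 * n ^ 2 := by
  rw [finrank_range_surfaceBox_two K hn ha hc]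
  exact (FormulaN.Uniform.plainFamilyARank_eq n).1

/-- **C10's kernel, uniformly in `n ≥ 1`: `dim ker(θ ↦ θ ∧ F_n ∣ ⋀² K^{4n}) = 5n = plainFamilyAKer n`** (`dim ⋀² K^{4n} = C(4n,2) = 8n² − 2n`). -/
theorem finrank_ker_surfaceBox_two (hn : 1 ≤ n) {a c : K} (ha : a ≠ 0) (hc : c ≠ 0) :
    finrank K (LinearMap.ker (wedge K (Fin (4 * n)) 2 (surfaceBox K (n := n) a c))) =
      FormulaN.Uniform.plainFamilyAKer n := by
  have h1 := LinearMap.finrank_range_add_finrank_ker (wedge K (Fin (4 * n)) 2 (surfaceBox K (n := n) a c))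
  rw [finrank_range_surfaceBox_two K hn ha hc, exteriorPower.finrank_eq, finrank_fintype_fun_eq_card, Fintype.card_fin]
    at h1
  have h2 := (FormulaN.Uniform.plainFamilyARank_eq n).2
  rw [FormulaN.Uniform.dimHT, show n + n + n + n = 4 * n by ring] at h2
  omega

/-- the instances of record (STRUCTURE C10: `66/51/15`, `120/100/20`, `190/165/25` at `n = 3, 4, 5`; bench `276/246/30`, `378/343/35`,
`496/456/40` at `n = 6, 7, 8`): `(rank, ker)` on `⋀²`. -/
theorem instances_surfaceBox_two {a c : K} (ha : a ≠ 0) (hc : c ≠ 0) :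
    (finrank K (LinearMap.range (wedge K (Fin (4 * 3)) 2 (surfaceBox K (n := 3) a c))),
      finrank K (LinearMap.ker (wedge K (Fin (4 * 3)) 2 (surfaceBox K (n := 3) a c)))) = (51, 15) ∧
    (finrank K (LinearMap.range (wedge K (Fin (4 * 4)) 2 (surfaceBox K (n := 4) a c))),
      finrank K (LinearMap.ker (wedge K (Fin (4 * 4)) 2 (surfaceBox K (n := 4) a c)))) = (100, 20) ∧
    (finrank K (LinearMap.range (wedge K (Fin (4 * 5)) 2 (surfaceBox K (n := 5) a c))),
      finrank K (LinearMap.ker (wedge K (Fin (4 * 5)) 2 (surfaceBox K (n := 5) a c)))) = (165, 25) := by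
  refine ⟨?_, ?_, ?_⟩ <;>
    rw [finrank_range_surfaceBox_two K (by omega) ha hc, finrank_ker_surfaceBox_two K (by omega) ha hc] <;> decide

/-- **degree 3, uniformly in `n ≥ 1`**: `rank(θ ↦ θ ∧ F_n ∣ ⋀³ K^{4n}) = 64·C(n,3) + 8·C(n,2)` (STRUCTURE C14's family-A column
«HT³ … 88 · 304 · 720 · 1400 at n = 3..6 = [t³](1+4t+t²)ⁿ»). -/
theorem finrank_range_surfaceBox_three (hn : 1 ≤ n) {a c : K} (ha : a ≠ 0) (hc : c ≠ 0) :
    finrank K (LinearMap.range (wedge K (Fin (4 * n)) 3 (surfaceBox K (n := n) a c))) = 64 * n.choose 3 + 8 * n.choose 2 := by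
  rw [finrank_range_surfaceBox K hn ha hc, (coeff_surfPoly_pow n).2.2.2]

/-- the degree-3 instances of record: `88`, `304`, `720` at `n = 3, 4, 5`. -/
theorem instances_surfaceBox_three {a c : K} (ha : a ≠ 0) (hc : c ≠ 0) :
    finrank K (LinearMap.range (wedge K (Fin (4 * 3)) 3 (surfaceBox K (n := 3) a c))) = 88 ∧
    finrank K (LinearMap.range (wedge K (Fin (4 * 4)) 3 (surfaceBox K (n := 4) a c))) = 304 ∧
    finrank K (LinearMap.range (wedge K (Fin (4 * 5)) 3 (surfaceBox K (n := 5) a c))) = 720 := by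
  refine ⟨?_, ?_, ?_⟩ <;> rw [finrank_range_surfaceBox_three K (by omega) ha hc] <;> decide

end Summit.Ventures.HSemireg.Wedge.SurfacePowers
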